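import Literature.MathematicalPhysics.QuantumFieldTheory.FiniteTemperatureTimeTranslations
import Literature.Barriers.QuantumFields.FiniteTemperatureDeconfinementInfrared
import Literature.Barriers.QuantumFields.FiniteTemperatureSpatialReflection
import HarnessLib

/-!
# Spatial axis symmetry of Borgs–Seiler's finite-temperature lattice, translation of local observables, and the
# Gibbs–Jensen inequality for the electric coupling

Topic `Literature/MathematicalPhysics/QuantumFieldTheory`; vocabulary of `Literature.Barriers.QuantumFields.FiniteTemperature*`
(`Config d L₀ L G` on `ℤ_{L₀} × (ℤ/L)^d`, weight `weight ρ J_E J_M = exp(J_E S_E + J_M S_M)`, a-priori measure `haar`), of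
`FiniteTemperatureDeconfinementInfrared.lean` (spatial translations) and `FiniteTemperatureTimeTranslations.lean`.  Three pieces of
bookkeeping for a volume-UNIFORM lower bound on the temporal plaquette at finite temperature (sequel
`FiniteTemperatureTemporalPlaquetteFloor.lean`), all elementary and all proved:

* `axisSwap i j` — the transposition of two SPATIAL axes acting on configurations (sites `(t, y) ↦ (t, y ∘ (i j))`, directions
  `k ↦ (i j) k`, time fixed); `plaquette_axisSwap`, `minusAction_axisSwap` (the finite-temperature Wilson action is invariant: all
  spatial directions are equivalent, the temporal one is singled out only by its coupling), `measurePreserving_axisSwap`,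
  ★ `integral_elecPlaquette_mul_weight_eq_of_dir` — the weighted integral of `Re tr ρ(U_□)` is the same for the `(time, i)` and the
  `(time, j)` plaquettes at the origin;
* `integral_elecPlaquette_mul_weight_eq_origin` — and the same at every site (space and time translations); hence
  ★ `integral_elecAction_mul_weight` : `∫ S_E e^{-S} = L₀ · L^d · d · ∫ Re tr ρ(U_{□,(0,0),i}) e^{-S}`;
* ★ `exp_jensen_weight` — `Z⁻¹ ∫ e^{X} e^{-S} ≥ exp(Z⁻¹ ∫ X e^{-S})` for continuous `X` (from `e^y ≥ 1 + y`), and its consequence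
  ★★ `mul_integral_elecAction_ge` : `β · ∫ S_E e^{-S_β} ≥ Z_β (log Z_β - log Z₀)`, where `Z_β`, `Z₀` are the partition functions at
  electric coupling `β` and `0` (same `J_M`) — the supporting-line / Gibbs inequality for the convex pressure in `J_E`
  (Friedli–Velenik Lemma 3.5; Montvay–Münster (3.113)).

HONEST FRAMING: symmetry and convexity bookkeeping at fixed finite volume; no estimate of a plaquette or of a mass gap is made here.

References: S. Friedli, Y. Velenik, *Statistical Mechanics of Lattice Systems* (CUP 2017), Lemma 3.5, App. B.8.1; I. Montvay, G. Münster,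
*Quantum Fields on a Lattice* (1994) §3.2.6 (3.113), (3.145); C. Borgs, E. Seiler, Commun. Math. Phys. 91 (1983) 329, §II.3.
-/

noncomputable section

open MeasureTheory Filter Topology Finset
open scoped BigOperators

namespace Literature.Barriers.QuantumFields

namespace FiniteTemperature

open Literature.MathematicalPhysics.QuantumFieldTheory

/-! ### The transposition of two spatial axes -/

section Swap

variable {d L₀ L : ℕ} {G : Type*}

/-- The transposition `(i j)` of two spatial axes on sites: `(t, y) ↦ (t, y ∘ (i j))`. [cite: MontvayMunster1994, §3.2.6 (3.145)] -/
def axisSwapSite (i j : Fin d) (x : Site d L₀ L) : Site d L₀ L := (x.1, fun k => x.2 (Equiv.swap i j k))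

/-- The transposition on directions: time fixed, `k ↦ (i j) k`. [cite: MontvayMunster1994, §3.2.6 (3.145)] -/
def axisSwapDir (i j : Fin d) : Dir d → Dir d
  | none => none
  | some k => some (Equiv.swap i j k)

/-- The transposition on links. [cite: MontvayMunster1994, §3.2.6 (3.145)] -/
def axisSwapLink (i j : Fin d) (e : Site d L₀ L × Dir d) : Site d L₀ L × Dir d := (axisSwapSite i j e.1, axisSwapDir i j e.2)

/-- **The transposition of two spatial axes on configurations**: `(π U)(e) = U(π e)`. [cite: MontvayMunster1994, §3.2.6 (3.145)] -/
def axisSwap (i j : Fin d) (U : Config d L₀ L G) : Config d L₀ L G := fun e => U (axisSwapLink i j e)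

/-- The site transposition is an involution. [cite: MontvayMunster1994, §3.2.6 (3.145)] -/
theorem axisSwapSite_axisSwapSite (i j : Fin d) (x : Site d L₀ L) : axisSwapSite i j (axisSwapSite i j x) = x := by
  unfold axisSwapSite
  ext <;> simp [Equiv.swap_apply_self]

/-- The direction transposition is an involution. [cite: MontvayMunster1994, §3.2.6 (3.145)] -/
theorem axisSwapDir_axisSwapDir (i j : Fin d) (μ : Dir d) : axisSwapDir i j (axisSwapDir i j μ) = μ := by
  cases μ <;> simp [axisSwapDir, Equiv.swap_apply_self]

/-- The link transposition is an involution. [cite: MontvayMunster1994, §3.2.6 (3.145)] -/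
theorem axisSwapLink_axisSwapLink (i j : Fin d) (e : Site d L₀ L × Dir d) : axisSwapLink i j (axisSwapLink i j e) = e := by
  unfold axisSwapLink
  rw [axisSwapSite_axisSwapSite, axisSwapDir_axisSwapDir]

/-- The configuration transposition is an involution. [cite: MontvayMunster1994, §3.2.6 (3.145)] -/
theorem axisSwap_axisSwap (i j : Fin d) (U : Config d L₀ L G) : axisSwap i j (axisSwap i j U) = U := by
  funext e; simp [axisSwap, axisSwapLink_axisSwapLink]

/-- The direction transposition fixes time. [cite: MontvayMunster1994, §3.2.6 (3.145)] -/
@[simp] theorem axisSwapDir_none (i j : Fin d) : axisSwapDir (d := d) i j none = none := rfl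

/-- The direction transposition on spatial directions. [cite: MontvayMunster1994, §3.2.6 (3.145)] -/
@[simp] theorem axisSwapDir_some (i j k : Fin d) : axisSwapDir i j (some k) = some (Equiv.swap i j k) := rfl

/-- The site transposition as an equivalence. [cite: MontvayMunster1994, §3.2.6 (3.145)] -/
def axisSwapSiteEquiv (i j : Fin d) : Site d L₀ L ≃ Site d L₀ L :=
  ⟨axisSwapSite i j, axisSwapSite i j, axisSwapSite_axisSwapSite i j, axisSwapSite_axisSwapSite i j⟩

/-- Pointwise form. [cite: MontvayMunster1994, §3.2.6 (3.145)] -/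
@[simp] theorem axisSwapSiteEquiv_apply (i j : Fin d) (x : Site d L₀ L) : axisSwapSiteEquiv i j x = axisSwapSite i j x := rfl

/-- The transposition of sites intertwines the elementary steps: `π(x + e_μ) = π(x) + e_{π μ}`. [cite: MontvayMunster1994, §3.2.6 (3.145)] -/
theorem axisSwapSite_shift (i j : Fin d) (x : Site d L₀ L) (μ : Dir d) :
    axisSwapSite i j (x.shift μ) = (axisSwapSite i j x).shift (axisSwapDir i j μ) := by
  cases μ with
  | none => rfl
  | some k =>
    unfold axisSwapSite axisSwapDir Site.shift
    ext l
    · rfl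
    · simp only [Pi.add_apply]
      congr 1
      by_cases h : Equiv.swap i j l = k
      · have hl : l = Equiv.swap i j k := by rw [← h, Equiv.swap_apply_self]
        rw [h, hl, Pi.single_eq_same, Pi.single_eq_same]
      · have hl : l ≠ Equiv.swap i j k := fun hl => h (by rw [hl, Equiv.swap_apply_self])
        rw [Pi.single_eq_of_ne h, Pi.single_eq_of_ne hl]

variable [Group G] {N : ℕ}

/-- **Plaquettes of the transposed configuration** are transposed plaquettes: `(πU)_P(x; μ, ν) = U_P(πx; πμ, πν)`.
[cite: MontvayMunster1994, §3.2.6 (3.145)] -/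
theorem plaquette_axisSwap (i j : Fin d) (U : Config d L₀ L G) (x : Site d L₀ L) (μ ν : Dir d) :
    plaquette (axisSwap i j U) x μ ν = plaquette U (axisSwapSite i j x) (axisSwapDir i j μ) (axisSwapDir i j ν) := by
  unfold plaquette axisSwap axisSwapLink
  simp only [axisSwapSite_shift]

variable (ρ : G →* Matrix (Fin N) (Fin N) ℂ)

/-- A symmetric function summed over ordered pairs `k < l` of `Fin d`: half of the off-diagonal sum (plumbing for the magnetic part of
the action under a permutation of the axes). [cite: MontvayMunster1994, §3.2.6 (3.145)] -/
theorem sum_pairs_lt_eq (g : Fin d → Fin d → ℝ) (hg : ∀ k l, g k l = g l k) :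
    ∑ p : {p : Fin d × Fin d // p.1 < p.2}, g p.1.1 p.1.2 = ((∑ k, ∑ l, g k l) - ∑ k, g k k) / 2 := by
  classical
  have hsub : ∑ p : {p : Fin d × Fin d // p.1 < p.2}, g p.1.1 p.1.2 =
      ∑ p ∈ (Finset.univ : Finset (Fin d × Fin d)).filter (fun p => p.1 < p.2), g p.1 p.2 :=
    (Finset.sum_subtype ((Finset.univ : Finset (Fin d × Fin d)).filter (fun p => p.1 < p.2)) (fun p => by simp)
      (fun p : Fin d × Fin d => g p.1 p.2)).symm
  have htot : ∑ k, ∑ l, g k l = ∑ p : Fin d × Fin d, g p.1 p.2 := by rw [Fintype.sum_prod_type]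
  have hsplit : ∑ p : Fin d × Fin d, g p.1 p.2 =
      (∑ p ∈ (Finset.univ : Finset (Fin d × Fin d)).filter (fun p => p.1 < p.2), g p.1 p.2) +
        ((∑ p ∈ (Finset.univ : Finset (Fin d × Fin d)).filter (fun p => p.2 < p.1), g p.1 p.2) +
          ∑ p ∈ (Finset.univ : Finset (Fin d × Fin d)).filter (fun p => p.1 = p.2), g p.1 p.2) := by
    rw [← Finset.sum_filter_add_sum_filter_not Finset.univ (fun p : Fin d × Fin d => p.1 < p.2)]
    congr 1
    rw [← Finset.sum_filter_add_sum_filter_not _ (fun p : Fin d × Fin d => p.2 < p.1)]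
    congr 1
    · congr 1; ext p; simp only [Finset.mem_filter, Finset.mem_univ, true_and, not_lt]
      constructor
      · rintro ⟨_, h2⟩; exact h2
      · intro h; exact ⟨h.le, h⟩
    · congr 1; ext p; simp only [Finset.mem_filter, Finset.mem_univ, true_and, not_lt]
      constructor
      · rintro ⟨h1, h2⟩; exact le_antisymm h2 h1
      · intro h; exact ⟨h.ge, h.le⟩
  have hgt : ∑ p ∈ (Finset.univ : Finset (Fin d × Fin d)).filter (fun p => p.2 < p.1), g p.1 p.2 =
      ∑ p ∈ (Finset.univ : Finset (Fin d × Fin d)).filter (fun p => p.1 < p.2), g p.1 p.2 := by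
    refine Finset.sum_nbij' (fun p => (p.2, p.1)) (fun p => (p.2, p.1)) ?_ ?_ ?_ ?_ ?_
    · intro p hp; simp only [Finset.mem_filter, Finset.mem_univ, true_and] at hp ⊢; exact hp
    · intro p hp; simp only [Finset.mem_filter, Finset.mem_univ, true_and] at hp ⊢; exact hp
    · intro p _; rfl
    · intro p _; rfl
    · intro p _; exact hg _ _
  have hdiag : ∑ p ∈ (Finset.univ : Finset (Fin d × Fin d)).filter (fun p => p.1 = p.2), g p.1 p.2 = ∑ k, g k k := by
    rw [Finset.sum_filter, Fintype.sum_prod_type]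
    exact Finset.sum_congr rfl fun k _ => by rw [Finset.sum_ite_eq, if_pos (Finset.mem_univ _)]
  rw [hsub, htot, hsplit, hgt, hdiag]
  ring

/-- **The finite-temperature Wilson action is invariant under a transposition of two spatial axes.**
[cite: MontvayMunster1994, §3.2.6 (3.145)] [cite: BorgsSeiler1983, §II.3 (II.20) (pp. 335–336)] -/
theorem minusAction_axisSwap [NeZero L₀] [NeZero L] (hρu : ∀ g, ρ g ∈ Matrix.unitaryGroup (Fin N) ℂ) (JE JM : ℝ) (i j : Fin d)
    (U : Config d L₀ L G) : minusAction ρ JE JM (axisSwap i j U) = minusAction ρ JE JM U := by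
  unfold minusAction
  simp_rw [plaquette_axisSwap, axisSwapDir_none, axisSwapDir_some]
  congr 1
  · congr 1
    symm
    calc ∑ x : Site d L₀ L, ∑ k : Fin d, (ρ (plaquette U x none (some k))).trace.re
        = ∑ x : Site d L₀ L, ∑ k : Fin d, (ρ (plaquette U (axisSwapSiteEquiv i j x) none (some k))).trace.re :=
          (Equiv.sum_comp (axisSwapSiteEquiv i j) (fun x => ∑ k : Fin d, (ρ (plaquette U x none (some k))).trace.re)).symm
      _ = ∑ x : Site d L₀ L, ∑ k : Fin d, (ρ (plaquette U (axisSwapSite i j x) none (some (Equiv.swap i j k)))).trace.re := by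
          refine Finset.sum_congr rfl fun x _ => ?_
          rw [axisSwapSiteEquiv_apply]
          exact (Equiv.sum_comp (Equiv.swap i j) (fun k => (ρ (plaquette U (axisSwapSite i j x) none (some k))).trace.re)).symm
  · congr 1
    symm
    rw [← Equiv.sum_comp (axisSwapSiteEquiv i j) (fun x => ∑ p : {p : Fin d × Fin d // p.1 < p.2},
      (ρ (plaquette U x (some p.1.1) (some p.1.2))).trace.re)]
    refine Finset.sum_congr rfl fun x _ => ?_
    rw [axisSwapSiteEquiv_apply]
    -- the magnetic sum over unordered pairs is invariant under the permutation of directions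
    set y : Site d L₀ L := axisSwapSite i j x with hy
    have hsymm : ∀ k l : Fin d, (ρ (plaquette U y (some k) (some l))).trace.re = (ρ (plaquette U y (some l) (some k))).trace.re := by
      intro k l; rw [plaquette_swap U y (some k) (some l), trace_re_rep_inv ρ hρu]
    have hsymm' : ∀ k l : Fin d, (ρ (plaquette U y (some (Equiv.swap i j k)) (some (Equiv.swap i j l)))).trace.re =
        (ρ (plaquette U y (some (Equiv.swap i j l)) (some (Equiv.swap i j k)))).trace.re := fun k l => hsymm _ _
    rw [sum_pairs_lt_eq (fun k l => (ρ (plaquette U y (some (Equiv.swap i j k)) (some (Equiv.swap i j l)))).trace.re) hsymm',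
      sum_pairs_lt_eq (fun k l => (ρ (plaquette U y (some k) (some l))).trace.re) hsymm]
    congr 2
    · exact (Equiv.sum_comp (Equiv.swap i j) (fun k => ∑ l, (ρ (plaquette U y (some k) (some l))).trace.re)).symm.trans
        (Finset.sum_congr rfl fun k _ =>
          (Equiv.sum_comp (Equiv.swap i j) (fun l => (ρ (plaquette U y (some (Equiv.swap i j k)) (some l))).trace.re)).symm)
    · exact (Equiv.sum_comp (Equiv.swap i j) (fun k => (ρ (plaquette U y (some k) (some k))).trace.re)).symm

/-- Hence the Boltzmann weight is invariant. [cite: BorgsSeiler1983, §II.3 (II.20) (pp. 335–336)] -/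
theorem weight_axisSwap [NeZero L₀] [NeZero L] (hρu : ∀ g, ρ g ∈ Matrix.unitaryGroup (Fin N) ℂ) (JE JM : ℝ) (i j : Fin d)
    (U : Config d L₀ L G) : weight ρ JE JM (axisSwap i j U) = weight ρ JE JM U := by
  unfold weight; rw [minusAction_axisSwap ρ hρu]

variable [TopologicalSpace G] [IsTopologicalGroup G] [CompactSpace G] [MeasurableSpace G] [BorelSpace G]

omit ρ in
/-- **The axis transposition preserves the a-priori measure** (a permutation of the factors). [cite: BorgsSeiler1983, §II.3 (II.20)–Lemma II.3 (p. 336)] -/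
theorem measurePreserving_axisSwap [NeZero L₀] [NeZero L] (i j : Fin d) :
    MeasurePreserving (axisSwap (G := G) (d := d) (L₀ := L₀) (L := L) i j) (haar d L₀ L G) (haar d L₀ L G) := by
  have hinv : Function.Involutive (axisSwapLink (d := d) (L₀ := L₀) (L := L) i j) := axisSwapLink_axisSwapLink i j
  have h := measurePreserving_piCongrLeft (fun _ : Site d L₀ L × Dir d => haarProbability G) hinv.toPerm.symm
  have hc : ⇑(MeasurableEquiv.piCongrLeft (fun _ : Site d L₀ L × Dir d => G) hinv.toPerm.symm) =
      axisSwap (G := G) (d := d) (L₀ := L₀) (L := L) i j := by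
    funext U; funext e
    rw [MeasurableEquiv.coe_piCongrLeft, Equiv.piCongrLeft_apply_eq_cast, cast_eq]
    rfl
  rw [hc] at h
  exact h

omit ρ in
/-- Change of variables by the axis transposition: `∫ f(πU) ∏dg = ∫ f(U) ∏dg`. [cite: BorgsSeiler1983, §II.3 (II.20)–Lemma II.3 (p. 336)] -/
theorem integral_comp_axisSwap [NeZero L₀] [NeZero L] {E : Type*} [NormedAddCommGroup E] [NormedSpace ℝ E] (i j : Fin d)
    (f : Config d L₀ L G → E) : ∫ U, f (axisSwap i j U) ∂haar d L₀ L G = ∫ U, f U ∂haar d L₀ L G := by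
  have hm := (measurePreserving_axisSwap (d := d) (L₀ := L₀) (L := L) (G := G) i j).measurable
  let e : Config d L₀ L G ≃ᵐ Config d L₀ L G :=
    { toFun := axisSwap i j, invFun := axisSwap i j, left_inv := fun U => axisSwap_axisSwap i j U,
      right_inv := fun U => axisSwap_axisSwap i j U, measurable_toFun := hm, measurable_invFun := hm }
  have hmp : MeasurePreserving e (haar d L₀ L G) (haar d L₀ L G) := measurePreserving_axisSwap i j
  exact hmp.integral_comp' f

/-- **★ All spatial directions are equivalent for the temporal plaquette**: the weighted integrals of `Re tr ρ(U_□)` over the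
`(time, i)` and the `(time, j)` plaquettes at the origin coincide. [cite: MontvayMunster1994, §3.2.6 (3.145)] -/
theorem integral_elecPlaquette_mul_weight_eq_of_dir [NeZero L₀] [NeZero L] (hρu : ∀ g, ρ g ∈ Matrix.unitaryGroup (Fin N) ℂ)
    (JE JM : ℝ) (i j : Fin d) :
    ∫ U, (ρ (plaquette U ((0 : ZMod L₀), (0 : Fin d → ZMod L)) none (some i))).trace.re * weight ρ JE JM U ∂haar d L₀ L G =
      ∫ U, (ρ (plaquette U ((0 : ZMod L₀), (0 : Fin d → ZMod L)) none (some j))).trace.re * weight ρ JE JM U ∂haar d L₀ L G := by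
  rw [← integral_comp_axisSwap i j (fun U => (ρ (plaquette U ((0 : ZMod L₀), (0 : Fin d → ZMod L)) none (some i))).trace.re *
    weight ρ JE JM U)]
  refine integral_congr_ae (Eventually.of_forall fun U => ?_)
  dsimp only
  rw [weight_axisSwap ρ hρu, plaquette_axisSwap]
  have hsite : axisSwapSite i j ((0 : ZMod L₀), (0 : Fin d → ZMod L)) = (0, 0) := by
    unfold axisSwapSite; ext <;> simp
  rw [hsite]
  simp [axisSwapDir]

end Swap

/-! ### Translating the temporal plaquette to the origin; the electric action -/

section Translate

variable {d L₀ L : ℕ} [NeZero L₀] [NeZero L] {G : Type*} [Group G] [TopologicalSpace G] [IsTopologicalGroup G]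
  [CompactSpace G] [MeasurableSpace G] [BorelSpace G] {N : ℕ}
variable (ρ : G →* Matrix (Fin N) (Fin N) ℂ)

/-- **Every temporal plaquette has the weighted integral of the one at the origin** (space and time translations).
[cite: BorgsSeiler1983, §II.3 (II.22) (p. 337)] -/
theorem integral_elecPlaquette_mul_weight_eq_origin (JE JM : ℝ) (k : Fin d) (t : ZMod L₀) (y : Fin d → ZMod L) :
    ∫ U, (ρ (plaquette U (t, y) none (some k))).trace.re * weight ρ JE JM U ∂haar d L₀ L G =
      ∫ U, (ρ (plaquette U ((0 : ZMod L₀), (0 : Fin d → ZMod L)) none (some k))).trace.re * weight ρ JE JM U ∂haar d L₀ L G := by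
  -- translate in time by `t` and in space by `y`
  have h1 := integral_comp_timeTranslate (d := d) (L₀ := L₀) (L := L) (G := G) t
    (fun U => (ρ (plaquette U ((0 : ZMod L₀), (0 : Fin d → ZMod L)) none (some k))).trace.re * weight ρ JE JM U)
  have hmp := measurePreserving_translateEquiv (d := d) (L₀ := L₀) (L := L) (G := G) y
  have h2 := hmp.integral_comp' (fun U => (ρ (plaquette (timeTranslate t U) ((0 : ZMod L₀), (0 : Fin d → ZMod L)) none
    (some k))).trace.re * weight ρ JE JM (timeTranslate t U))
  rw [coe_translateEquiv] at h2
  rw [← h1, ← h2]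
  refine integral_congr_ae (Eventually.of_forall fun U => ?_)
  dsimp only
  rw [weight_timeTranslate, weight_translate, plaquette_timeTranslate, timeSiteShift_apply, plaquette_translate, siteShift_apply]
  simp

variable [SecondCountableTopology G]

/-- **The electric action integrates to `L₀ · L^d · d` copies of one temporal plaquette**:
`∫ S_E e^{-S} = |ℤ_{L₀} × (ℤ/L)^d| · d · ∫ Re tr ρ(U_{□,(0,0),i}) e^{-S}` (translations and the equivalence of the spatial axes;
unitary `ρ`). [cite: MontvayMunster1994, §3.2.6 (3.113), (3.145)] -/
theorem integral_elecAction_mul_weight (hρu : ∀ g, ρ g ∈ Matrix.unitaryGroup (Fin N) ℂ) (hρ : Continuous ρ) (JE JM : ℝ) (i : Fin d) :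
    ∫ U, (∑ x : Site d L₀ L, ∑ k : Fin d, (ρ (plaquette U x none (some k))).trace.re) * weight ρ JE JM U ∂haar d L₀ L G =
      (Fintype.card (Site d L₀ L) * d : ℕ) *
        ∫ U, (ρ (plaquette U ((0 : ZMod L₀), (0 : Fin d → ZMod L)) none (some i))).trace.re * weight ρ JE JM U ∂haar d L₀ L G := by
  have hw := continuous_weight (d := d) (L₀ := L₀) (L := L) ρ hρ JE JM
  have hint : ∀ (x : Site d L₀ L) (k : Fin d), Integrable (fun U : Config d L₀ L G =>
      (ρ (plaquette U x none (some k))).trace.re * weight ρ JE JM U) (haar d L₀ L G) := fun x k =>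
    integrable_of_continuous ((Complex.continuous_re.comp (Continuous.matrix_trace (hρ.comp (continuous_plaquette x _ _)))).mul hw)
  simp_rw [Finset.sum_mul]
  rw [integral_finsetSum _ fun x _ => integrable_finsetSum _ fun k _ => hint x k]
  simp_rw [integral_finsetSum _ fun k _ => hint _ k]
  have hterm : ∀ (x : Site d L₀ L) (k : Fin d), ∫ U, (ρ (plaquette U x none (some k))).trace.re * weight ρ JE JM U ∂haar d L₀ L G =
      ∫ U, (ρ (plaquette U ((0 : ZMod L₀), (0 : Fin d → ZMod L)) none (some i))).trace.re * weight ρ JE JM U ∂haar d L₀ L G := by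
    intro x k
    rw [show x = (x.1, x.2) from rfl, integral_elecPlaquette_mul_weight_eq_origin ρ JE JM k x.1 x.2,
      integral_elecPlaquette_mul_weight_eq_of_dir ρ hρu JE JM k i]
  simp_rw [hterm]
  rw [Finset.sum_const, Finset.card_univ, Finset.sum_const, Finset.card_univ, Fintype.card_fin, smul_smul]
  simp [Nat.cast_mul, nsmul_eq_mul]

end Translate

/-! ### The Gibbs–Jensen inequality in the electric coupling -/

section Jensen

variable {d L₀ L : ℕ} [NeZero L₀] [NeZero L] {G : Type*} [Group G] [TopologicalSpace G] [IsTopologicalGroup G]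
  [CompactSpace G] [MeasurableSpace G] [BorelSpace G] [SecondCountableTopology G] {N : ℕ}
variable (ρ : G →* Matrix (Fin N) (Fin N) ℂ)

/-- **Jensen's inequality for the exponential against the Gibbs weight**: for continuous `X`,
`exp((∫ X e^{-S}) / Z) · Z ≤ ∫ e^{X} e^{-S}` (from `e^{y} ≥ 1 + y` at `y = X - ⟨X⟩`). [cite: FriedliVelenik2017, Lemma 3.5 and App. B.8.1] -/
theorem exp_jensen_weight (hρ : Continuous ρ) (JE JM : ℝ) {X : Config d L₀ L G → ℝ} (hX : Continuous X) :
    Real.exp ((∫ U, X U * weight ρ JE JM U ∂haar d L₀ L G) / ∫ U, weight ρ JE JM U ∂haar d L₀ L G) *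
        ∫ U, weight ρ JE JM U ∂haar d L₀ L G ≤
      ∫ U, Real.exp (X U) * weight ρ JE JM U ∂haar d L₀ L G := by
  have hw := continuous_weight (d := d) (L₀ := L₀) (L := L) ρ hρ JE JM
  set Z : ℝ := ∫ U, weight ρ JE JM U ∂haar d L₀ L G with hZ
  have hZpos : 0 < Z := partitionFunction_pos ρ hρ JE JM
  set m : ℝ := (∫ U, X U * weight ρ JE JM U ∂haar d L₀ L G) / Z with hm
  have hpt : ∀ U, Real.exp m * ((1 + (X U - m)) * weight ρ JE JM U) ≤ Real.exp (X U) * weight ρ JE JM U := by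
    intro U
    have h1 : 1 + (X U - m) ≤ Real.exp (X U - m) := by linarith [Real.add_one_le_exp (X U - m)]
    have h2 : Real.exp m * Real.exp (X U - m) = Real.exp (X U) := by rw [← Real.exp_add]; ring_nf
    calc Real.exp m * ((1 + (X U - m)) * weight ρ JE JM U) = (Real.exp m * (1 + (X U - m))) * weight ρ JE JM U := by ring
      _ ≤ (Real.exp m * Real.exp (X U - m)) * weight ρ JE JM U :=
          mul_le_mul_of_nonneg_right (mul_le_mul_of_nonneg_left h1 (Real.exp_pos _).le) (weight_pos ρ JE JM U).le
      _ = Real.exp (X U) * weight ρ JE JM U := by rw [h2]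
  have hi1 : Integrable (fun U => (1 + (X U - m)) * weight ρ JE JM U) (haar d L₀ L G) :=
    integrable_of_continuous ((continuous_const.add (hX.sub continuous_const)).mul hw)
  have hi2 : Integrable (fun U => Real.exp (X U) * weight ρ JE JM U) (haar d L₀ L G) :=
    integrable_of_continuous ((Real.continuous_exp.comp hX).mul hw)
  have hlhs : ∫ U, (1 + (X U - m)) * weight ρ JE JM U ∂haar d L₀ L G = Z := by
    have e1 : (fun U => (1 + (X U - m)) * weight ρ JE JM U) = fun U => weight ρ JE JM U + (X U * weight ρ JE JM U - m * weight ρ JE JM U) := by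
      funext U; ring
    rw [e1, integral_add (integrable_of_continuous hw), integral_sub, integral_const_mul, hm]
    · field_simp; ring
    · exact integrable_of_continuous (hX.mul hw)
    · exact integrable_of_continuous (continuous_const.mul hw)
    · exact (integrable_of_continuous (hX.mul hw)).sub (integrable_of_continuous (continuous_const.mul hw))
  calc Real.exp m * Z = Real.exp m * ∫ U, (1 + (X U - m)) * weight ρ JE JM U ∂haar d L₀ L G := by rw [hlhs]
    _ = ∫ U, Real.exp m * ((1 + (X U - m)) * weight ρ JE JM U) ∂haar d L₀ L G := (integral_const_mul _ _).symm
    _ ≤ ∫ U, Real.exp (X U) * weight ρ JE JM U ∂haar d L₀ L G := integral_mono (hi1.const_mul _) hi2 hpt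

/-- **★★ The Gibbs inequality for the electric coupling** (supporting line of the convex pressure `J_E ↦ log Z(J_E, J_M)`):
`β · ∫ S_E e^{-S_{β,J_M}} ≥ Z_β (log Z_β - log Z₀)` where `S_E = Σ_x Σ_k Re tr ρ(U_{(x;time,k)})` is the electric action,
`Z_β = ∫ e^{βS_E + J_M S_M}`, `Z₀ = ∫ e^{J_M S_M}` (Jensen: `Z₀/Z_β = ⟨e^{-βS_E}⟩_β ≥ e^{-β⟨S_E⟩_β}`).
[cite: FriedliVelenik2017, Lemma 3.5 and App. B.8.1] [cite: MontvayMunster1994, §3.2.6 (3.113)] -/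
theorem mul_integral_elecAction_ge (hρ : Continuous ρ) (β JM : ℝ) :
    (∫ U, weight ρ β JM U ∂haar d L₀ L G) *
        (Real.log (∫ U, weight ρ β JM U ∂haar d L₀ L G) - Real.log (∫ U, weight ρ 0 JM U ∂haar d L₀ L G)) ≤
      β * ∫ U, (∑ x : Site d L₀ L, ∑ k : Fin d, (ρ (plaquette U x none (some k))).trace.re) * weight ρ β JM U ∂haar d L₀ L G := by
  set SE : Config d L₀ L G → ℝ := fun U => ∑ x : Site d L₀ L, ∑ k : Fin d, (ρ (plaquette U x none (some k))).trace.re with hSE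
  have hSEc : Continuous SE := continuous_finsetSum _ fun x _ => continuous_finsetSum _ fun k _ =>
    Complex.continuous_re.comp (Continuous.matrix_trace (hρ.comp (continuous_plaquette x _ _)))
  set Zβ : ℝ := ∫ U, weight ρ β JM U ∂haar d L₀ L G with hZβ
  set Z0 : ℝ := ∫ U, weight ρ 0 JM U ∂haar d L₀ L G with hZ0
  have hZβ_pos : 0 < Zβ := partitionFunction_pos ρ hρ β JM
  have hZ0_pos : 0 < Z0 := partitionFunction_pos ρ hρ 0 JM
  -- `∫ e^{-β S_E} e^{-S_β} = Z₀`
  have hkey : ∫ U, Real.exp (-β * SE U) * weight ρ β JM U ∂haar d L₀ L G = Z0 := by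
    rw [hZ0]
    refine integral_congr_ae (Eventually.of_forall fun U => ?_)
    dsimp only
    unfold weight minusAction
    rw [← Real.exp_add]
    congr 1
    simp only [hSE, zero_mul, zero_add]
    ring
  have hj := exp_jensen_weight (d := d) (L₀ := L₀) (L := L) ρ hρ β JM (X := fun U => -β * SE U) (continuous_const.mul hSEc)
  rw [hkey] at hj
  -- take logarithms
  have hm : (∫ U, -β * SE U * weight ρ β JM U ∂haar d L₀ L G) = -β * ∫ U, SE U * weight ρ β JM U ∂haar d L₀ L G := by
    rw [← integral_const_mul]; refine integral_congr_ae (Eventually.of_forall fun U => ?_); ring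
  rw [hm] at hj
  have hlog := Real.log_le_log (mul_pos (Real.exp_pos _) hZβ_pos) hj
  rw [Real.log_mul (Real.exp_pos _).ne' hZβ_pos.ne', Real.log_exp] at hlog
  have : -β * (∫ U, SE U * weight ρ β JM U ∂haar d L₀ L G) / Zβ * Zβ = -β * ∫ U, SE U * weight ρ β JM U ∂haar d L₀ L G := by
    field_simp
  nlinarith [hlog, this, hZβ_pos]

end Jensen

end FiniteTemperature

end Literature.Barriers.QuantumFields

end
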